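import Mathlib
import Summits.KontsevichZagierPeriods.Zeta5Search.CasoratianClassBoundProof
import HarnessLib

/-!
# ζ(5) search — THEOREM C for the ζ(3)-coefficient (`WrappedDivisibilityW`) is a THEOREM

Cell `pub-zeta5` (HONEST FRAMING: systematic search; no irrationality claim unless certified), typer seat
generation 8.  Discharges BY NAME gen-2 g6's THEOREM C for `W` (`ClusterValuation.WrappedDivisibilityW`, REPORT-gen2-g6 §3):
in the window `p² > b₀ + 2`, `p ≥ 5`, under the hypothesis `H(3)` (every class with at least two poles has `3 + E_x ≥ 1`),
the ζ(3)-coefficient `W(b)` is `p`-integral, and `p ∣ W(b)` as soon as `p ≤ d(b) + 1`.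

PROOF (the route printed in the statement file, now with every step a tree theorem): `W = Ω_p − 𝒦_p`
(`coeffW_eq_omegaRes_sub_kRes`); `𝒦_p = Σ_x 𝒦_x` (`kRes_eq_sum_classK`) with `v(𝒦_x) ≥ 1` for single-pole classes
(Theorem A′, `singlePoleClassKBound`), `v(𝒦_x) ≥ 3 + E_x ≥ 1` for multipole classes (Theorem A, `multipoleClassKBound`, and
`H(3)`), `𝒦_x = 0` for classes without poles; `Ω_p(b) = 0` for `p ≤ d+1` (`MomentVanishing`) and `Ω_p` is `p`-integral
(`MomentIntegral`).  This is the wrapped extension of the big-prime theorem (W∞) (`BigPrimeDivisibility_holds`, `p > b₀`) to the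
window `p ≤ b₀ < p² − 2`.  Valuation bookkeeping; nothing about irrationality.
-/

noncomputable section

open Finset

namespace Summit.KontsevichZagierPeriods.Zeta5Search.ClusterValuation

open Summit.KontsevichZagierPeriods.Zeta5Search.WedgeDictionary (coeffW dOf)
open Summit.KontsevichZagierPeriods.Zeta5Search.CasoratianValuation (InPolytope)
open Summit.KontsevichZagierPeriods.Zeta5Search.PadicSeries

variable {p : ℕ} [hp : Fact p.Prime]

/-- Under `H(3)`, every class piece of `𝒦_p` is divisible by `p`: `‖𝒦_x‖_p ≤ p^{−1}`. -/
theorem padicNorm_classK_le_of_good (b : ℕ → ℤ) (hb : InPolytope b) (hp5 : 5 ≤ p) (hwin : (b 0 + 2 : ℤ) < (p : ℤ) ^ 2)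
    (hgood : GoodClasses b p 3) {x : ℕ} (hx : x < p) : padicNorm p (classK b p x) ≤ (p : ℚ) ^ (-(1 : ℤ)) := by
  rcases Nat.lt_trichotomy (classPoleCount b p x) 1 with hc | hc | hc
  · rw [classK_eq_zero_of_noPole b hb (by omega), padicNorm.zero]; exact zpow_p_nonneg _
  · exact padicNorm_classK_le_single b hb hp5 hwin hx hc
  · have hE : (1 : ℤ) ≤ 3 + classExp b p x := by
      have := hgood x hx (by omega); push_cast at this; linarith
    exact (padicNorm_classK_le_multi b hb hp5 hwin hx (by omega)).trans (zpow_le_zpow_right₀ one_le_p (by linarith))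

/-- Under `H(3)`: `‖𝒦_p(b)‖_p ≤ p^{−1}`. -/
theorem padicNorm_kRes_le_of_good (b : ℕ → ℤ) (hb : InPolytope b) (hp5 : 5 ≤ p) (hwin : (b 0 + 2 : ℤ) < (p : ℤ) ^ 2)
    (hgood : GoodClasses b p 3) : padicNorm p (kRes b p) ≤ (p : ℚ) ^ (-(1 : ℤ)) := by
  rw [kRes_eq_sum_classK b hp.out.pos]
  exact padicNorm.sum_le' (fun x hx => padicNorm_classK_le_of_good b hb hp5 hwin hgood (mem_range.1 hx)) (zpow_p_nonneg _)

/-- **THEOREM C for `W` is a theorem** (wrapped extension of (W∞)): under `H(3)`, `W(b)` is `p`-integral and `p ∣ W(b)`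
for `p ≤ d(b)+1`. -/
theorem wrappedDivisibilityW_holds : WrappedDivisibilityW := by
  intro b p hb hprime hp5 hwin hgood hW
  haveI : Fact p.Prime := ⟨hprime⟩
  have hK := padicNorm_kRes_le_of_good b hb hp5 hwin hgood
  apply val_ge_of_padicNorm_le hW
  rw [coeffW_eq_omegaRes_sub_kRes b p]
  split_ifs with hpd
  · rw [omegaRes_eq_zero b hb hpd, zero_sub, padicNorm.neg]
    exact hK
  · refine (padicNorm.sub (p := p)).trans (max_le ?_ (hK.trans (zpow_le_zpow_right₀ one_le_p (by norm_num))))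
    simpa using padicNorm_omegaRes_le_one b hb (by omega)

end Summit.KontsevichZagierPeriods.Zeta5Search.ClusterValuation

end
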